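import Literature.NumberTheory.Automorphic.AutomorphicFormsReproducingKernel
import Literature.NumberTheory.Automorphic.HaarGLnArchCoordinates
import Literature.NumberTheory.Automorphic.GLnExpChartCoordinates
import Literature.NumberTheory.Automorphic.AutomorphyDatumGLRegular
import Literature.NumberTheory.Automorphic.AutomorphicFormsGLContinuous
import HarnessLib

/-!
# Harish-Chandra's convolution identity `φ = φ ∗ α` for automorphic forms on `GL_n(𝔸_K)` holds
# (discharge of `AutomorphicRepsGL.exists_convolution_eq_self`)

Topic `NumberTheory/Automorphic`; sibling proof file of `HarishChandraConvolutionGL`, whose named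
fact `AutomorphicRepsGL.exists_convolution_eq_self hcpt` — for every automorphic form `φ` on
`GL_n(𝔸_K)` and every Haar measure `ν` on `GL_n(K_∞)` there is a continuous, compactly supported,
archimedean-smooth `α` with `φ(g) = ∫ φ(g x) α(x) dν(x)` for all `g` (Harish-Chandra 1966, Thm. 1;
Borel 1972, Thm. 3.18; Borel–Jacquet 1979, 4.3) — is PROVED here:
`AutomorphicRepsGL.exists_convolution_eq_self_holds`, by the route "elliptic annihilator +
fundamental solution" made unconditional in the tree:

1. `IsAutomorphicForm.exists_reproducing_chartExp` (`AutomorphicFormsReproducingKernel`; the `GL_n`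
   datum is regular, `AutomorphyDatum.isRegular_gl`): a basis `B` of `𝔤 = M_n(K_∞)` and, for
   every radius `ρ`, a smooth `α₀` supported in `B(0, ρ) ⊆ ℝ^d` with
   `φ(g) = ∫ α₀(t) φ(g exp(∑ tᵢBᵢ)) dt`;
2. `exists_coordWeight_of_expChart` (`GLnExpChartCoordinates`): for `ρ` small this is
   `∫ β(s) φ(g u(s)) ds` in the linear coordinates `s` of `M_n(K_∞)` (`u(s)` the unit with
   coordinates `s`), with `β` smooth compactly supported inside the units;
3. `exists_integral_haar_eq_integral_unitPull` (`HaarGLnArchCoordinates`): `dν = c |det L_x|⁻¹ ds`,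
   so `α = c⁻¹ (β · |det L|) ∘ coords` does it; `β · |det L|` is smooth
   (`contDiff_haarWeightGL_mul`, the determinant being a polynomial non-vanishing on the units), so
   `α` is archimedean-smooth (`isArchSmooth_comp_glCoord`).

Everything is proved; no definitions, no named facts.

## References

* Harish-Chandra, *Discrete series for semisimple Lie groups. II*, Acta Math. 116 (1966), Thm. 1
  [HarishChandra1966].
* A. Borel, *Représentations de groupes localement compacts*, LNM 276 (1972), Thm. 3.18
  [Borel1972].
* A. Borel, H. Jacquet, *Automorphic forms and automorphic representations*, Proc. Sympos. Pure
  Math. 33 (1979), Part 1, 4.3 (ii) [BorelJacquet1979].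
* G. B. Folland, *Introduction to Partial Differential Equations*, 2nd ed. (1995), Thm. (8.45),
  Cor. (6.34) [Folland2020].
-/

noncomputable section

open scoped MatrixGroups Matrix Topology ContDiff Classical
open Filter MeasureTheory NumberField NumberField.mixedEmbedding IsDedekindDomain Set Metric

namespace Literature.NumberTheory.Automorphic

-- Mathlib idiom (Mathlib/Algebra/Lie/OfAssociative.lean); needed to mention Lie subalgebras of matrix algebras
attribute [local instance 100] LieRing.ofAssociativeRing

variable {n : ℕ} {K : Type} [Field K] [NumberField K]

/-! ### 1. Smoothness of `β · |det L|` in coordinates -/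

/-- The determinant of left multiplication, read in coordinates, is a smooth function
(a polynomial in the coordinates). [folklore] -/
theorem contDiff_det_lFlow_matOf :
    ContDiff ℝ ∞ fun s : GlIdx n K → ℝ => LinearMap.det (lFlow (n := n) (K := K) (matOf s)) := by
  simp_rw [det_lFlow_eq]
  set b := glInfBasis n K with hb
  have e : ∀ s : GlIdx n K → ℝ,
      LinearMap.det (LinearMap.mulLeft ℝ (matOf s) : Matrix (Fin n) (Fin n) (mixedSpace K) →ₗ[ℝ] _) =
        ∑ σ : Equiv.Perm (GlIdx n K), (Equiv.Perm.sign σ : ℝ) *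
          ∏ i, LinearMap.toMatrix b b (LinearMap.mulLeft ℝ (matOf s)) (σ i) i := fun s => by
    rw [← LinearMap.det_toMatrix b, Matrix.det_apply']
  simp_rw [e]
  refine ContDiff.sum fun σ _ => contDiff_const.mul (contDiff_prod fun i _ => ?_)
  -- each entry is a linear functional of `s`
  let ℓ : (GlIdx n K → ℝ) →ₗ[ℝ] ℝ :=
    { toFun := fun s => LinearMap.toMatrix b b (LinearMap.mulLeft ℝ (matOf s)) (σ i) i
      map_add' := fun s s' => by
        simp only [matOf, map_add]
        rw [show LinearMap.mulLeft ℝ ((glCoord n K).symm s + (glCoord n K).symm s') =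
          LinearMap.mulLeft ℝ ((glCoord n K).symm s) + LinearMap.mulLeft ℝ ((glCoord n K).symm s') from
          LinearMap.ext fun x => add_mul _ _ _]
        simp
      map_smul' := fun c s => by
        simp only [matOf, map_smul, RingHom.id_apply]
        rw [show LinearMap.mulLeft ℝ (c • (glCoord n K).symm s) =
          c • LinearMap.mulLeft ℝ ((glCoord n K).symm s) from LinearMap.ext fun x => smul_mul_assoc _ _ _]
        simp }
  exact (LinearMap.toContinuousLinearMap ℓ).contDiff

/-- The Haar weight `haarWeightGL = |det L|` is smooth at the units. [folklore] -/
theorem contDiffAt_haarWeightGL {s : GlIdx n K → ℝ} (hs : s ∈ glUnitSet n K) :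
    ContDiffAt ℝ ∞ (haarWeightGL n K) s := by
  have hne : LinearMap.det (lFlow (n := n) (K := K) (matOf s)) ≠ 0 := by
    obtain ⟨u, hu⟩ := (mem_glUnitSet_iff s).1 hs
    rw [← hu]; exact det_lFlow_ne_zero u
  exact (contDiffAt_abs hne).comp s contDiff_det_lFlow_matOf.contDiffAt

/-- **`β · |det L|` is smooth** for a smooth `β` supported inside the units. [folklore] -/
theorem contDiff_haarWeightGL_mul {β : (GlIdx n K → ℝ) → ℝ} (hβ : ContDiff ℝ ∞ β)
    (hβU : tsupport β ⊆ glUnitSet n K) :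
    ContDiff ℝ ∞ fun s => β s * haarWeightGL n K s := by
  refine contDiff_iff_contDiffAt.2 fun s => ?_
  by_cases hs : s ∈ glUnitSet n K
  · exact hβ.contDiffAt.mul (contDiffAt_haarWeightGL hs)
  · have hs' : s ∉ tsupport β := fun h => hs (hβU h)
    have hev : (fun s => β s * haarWeightGL n K s) =ᶠ[𝓝 s] fun _ => 0 := by
      filter_upwards [notMem_tsupport_iff_eventuallyEq.1 hs'] with x hx
      rw [hx, Pi.zero_apply, zero_mul]
    exact (contDiffAt_const (c := (0 : ℝ))).congr_of_eventuallyEq hev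

/-! ### 2. Archimedean smoothness of functions factoring through smooth functions of the coordinates -/

set_option backward.isDefEq.respectTransparency false in
open scoped Matrix.Norms.Operator in
/-- **A smooth function of the coordinates is archimedean-smooth on `GL_n(K_∞)`**: if
`γ : ℝ^D → ℂ` is smooth then `x ↦ γ (glCoord x)` is smooth in the sense of `IsArchSmooth` for the
full linear group (`Y ↦ u exp Y` is smooth into `M_n(K_∞)`). [folklore] -/
theorem isArchSmooth_comp_glCoord {γ : (GlIdx n K → ℝ) → ℂ} (hγ : ContDiff ℝ ∞ γ) :
    IsArchSmooth (archGroupGL n K).carrier.subtype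
      fun x : GL (Fin n) (mixedSpace K) => γ (glCoord n K (x : Matrix (Fin n) (Fin n) (mixedSpace K))) := by
  intro g
  have hexp : ContDiff ℝ ∞ (NormedSpace.exp : Matrix (Fin n) (Fin n) (mixedSpace K) → _) := contDiff_exp_matrix
  have hval : ContDiff ℝ ∞ fun Y : (archGroupGL n K).lie.toSubmodule => (Y : Matrix (Fin n) (Fin n) (mixedSpace K)) :=
    ((archGroupGL n K).lie.toSubmodule.subtypeL).contDiff
  have h1 : ContDiff ℝ ∞ fun Y : (archGroupGL n K).lie.toSubmodule =>
      (g : Matrix (Fin n) (Fin n) (mixedSpace K)) * NormedSpace.exp (Y : Matrix (Fin n) (Fin n) (mixedSpace K)) :=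
    contDiff_const.mul (hexp.comp hval)
  have h2 : ContDiff ℝ ∞ fun Y : (archGroupGL n K).lie.toSubmodule =>
      glCoord n K ((g : Matrix (Fin n) (Fin n) (mixedSpace K)) * NormedSpace.exp (Y : Matrix _ _ _)) :=
    (glCoord n K).contDiff.comp h1
  have e : (fun X : (archGroupGL n K).lie.toSubmodule =>
      γ (glCoord n K (((g * (archGroupGL n K).carrier.subtype ((archGroupGL n K).expMem ⟨X, X.2⟩) :
        GL (Fin n) (mixedSpace K)) : Matrix (Fin n) (Fin n) (mixedSpace K))))) =
      γ ∘ fun Y : (archGroupGL n K).lie.toSubmodule =>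
        glCoord n K ((g : Matrix (Fin n) (Fin n) (mixedSpace K)) * NormedSpace.exp (Y : Matrix _ _ _)) := by
    funext Y
    simp only [Function.comp_apply, Subgroup.coe_subtype, Units.val_mul, RealMatrixGroup.coe_expMem,
      coe_expGL]
  change ContDiff ℝ ∞ fun X : (archGroupGL n K).lie.toSubmodule =>
      γ (glCoord n K (((g * (archGroupGL n K).carrier.subtype ((archGroupGL n K).expMem ⟨X, X.2⟩) :
        GL (Fin n) (mixedSpace K)) : Matrix (Fin n) (Fin n) (mixedSpace K))))
  rw [e]
  exact hγ.comp h2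

/-! ### 3. The discharge -/

/-- The linear chart `Λ_B : ℝ^d ≃L M_n(K_∞)` of a basis `B` of the (full) Lie algebra of the
`GL_n` datum: `Λ_B t = ∑ tᵢ Bᵢ`, so that `exp (Λ_B t)` is the matrix of `chartExp B t`. [folklore] -/
theorem exists_linearChart_of_basis (hcpt : isCompact_glFiniteIntegralLevel n K) {d : ℕ}
    (B : Module.Basis (Fin d) ℝ (AutomorphyDatum.gl n K hcpt).arch.lie.toSubmodule) :
    ∃ Λ : (Fin d → ℝ) ≃L[ℝ] Matrix (Fin n) (Fin n) (mixedSpace K),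
      ∀ t, Λ t = ((B.equivFun.symm t : (AutomorphyDatum.gl n K hcpt).arch.lie.toSubmodule) :
        Matrix (Fin n) (Fin n) (mixedSpace K)) := by
  have hmem : ∀ X : Matrix (Fin n) (Fin n) (mixedSpace K),
      X ∈ (AutomorphyDatum.gl n K hcpt).arch.lie.toSubmodule := fun X => by
    change X ∈ ((⊤ : LieSubalgebra ℝ (Matrix (Fin n) (Fin n) (mixedSpace K))) : Submodule ℝ _)
    simp
  let ΛL : (Fin d → ℝ) →ₗ[ℝ] Matrix (Fin n) (Fin n) (mixedSpace K) :=
    (AutomorphyDatum.gl n K hcpt).arch.lie.toSubmodule.subtype ∘ₗ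
      (B.equivFun.symm : (Fin d → ℝ) →ₗ[ℝ] (AutomorphyDatum.gl n K hcpt).arch.lie.toSubmodule)
  have hΛL : ∀ t, ΛL t = ((B.equivFun.symm t : (AutomorphyDatum.gl n K hcpt).arch.lie.toSubmodule) :
      Matrix (Fin n) (Fin n) (mixedSpace K)) := fun t => rfl
  have hbij : Function.Bijective ΛL := by
    refine ⟨Subtype.val_injective.comp B.equivFun.symm.injective, fun X => ?_⟩
    refine ⟨B.equivFun ⟨X, hmem X⟩, ?_⟩
    rw [hΛL, LinearEquiv.symm_apply_apply]
  refine ⟨(LinearEquiv.ofBijective ΛL hbij).toContinuousLinearEquiv, fun t => ?_⟩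
  rfl

/-- **Harish-Chandra's convolution identity holds for automorphic forms on `GL_n(𝔸_K)`**
(discharge of `AutomorphicRepsGL.exists_convolution_eq_self hcpt`): for every automorphic form `φ`
and every Haar measure `ν` on `GL_n(K_∞)` there is a continuous, compactly supported,
archimedean-smooth `α : GL_n(K_∞) → ℂ` with `φ(g) = ∫ φ(g x) α(x) dν(x)` for all `g ∈ GL_n(𝔸_K)`.
See the module docstring for the proof (elliptic annihilator and fundamental solution in
exponential coordinates, change of variables to linear coordinates, Haar measure in linear
coordinates). Harish-Chandra 1966, Thm. 1; Borel 1972, Thm. 3.18; Borel–Jacquet 1979, 4.3 (ii):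
"for `f ∈ 𝒜` there is `α ∈ C_c^∞(G_∞)` with `f ∗ α = f`". [cite: BorelJacquet1979, 4.3] -/
theorem AutomorphicRepsGL.exists_convolution_eq_self_holds (hcpt : isCompact_glFiniteIntegralLevel n K) :
    AutomorphicRepsGL.exists_convolution_eq_self hcpt := by
  intro _ _ ν _ φ hφ
  -- 1. the reproducing identity in exponential coordinates
  obtain ⟨d, B, hB⟩ := hφ.exists_reproducing_chartExp (AutomorphyDatum.isRegular_gl hcpt)
  obtain ⟨Λ, hΛ⟩ := exists_linearChart_of_basis hcpt B
  have hexpΛ : ∀ t, NormedSpace.exp (Λ t) =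
      (((chartExp B t : (AutomorphyDatum.gl n K hcpt).arch.carrier) : GL (Fin n) (mixedSpace K)) :
        Matrix (Fin n) (Fin n) (mixedSpace K)) := fun t => by
    rw [hΛ t, coe_chartExp]
  -- 2. exponential versus linear coordinates
  obtain ⟨ρ₀, hρ₀, hcoord⟩ := exists_coordWeight_of_expChart (n := n) (K := K) Λ
  obtain ⟨α₀, hα₀s, hα₀c, hα₀ρ, hrep⟩ := hB ρ₀ hρ₀
  obtain ⟨β, hβs, hβc, hβU, hβ⟩ := hcoord α₀ hα₀s hα₀ρ
  -- 3. the Haar measure in linear coordinates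
  obtain ⟨c, hc, hhaar⟩ := exists_integral_haar_eq_integral_unitPull (n := n) (K := K) ν
  -- the weight
  set γ : (GlIdx n K → ℝ) → ℝ := fun s => β s * haarWeightGL n K s with hγ
  have hγs : ContDiff ℝ ∞ γ := contDiff_haarWeightGL_mul hβs hβU
  set α : GL (Fin n) (mixedSpace K) → ℂ := fun x =>
    ((c⁻¹ : ℝ) : ℂ) * (γ (glCoord n K (x : Matrix (Fin n) (Fin n) (mixedSpace K))) : ℂ) with hα
  have hαc : Continuous α := by
    refine continuous_const.mul (Complex.continuous_ofReal.comp (hγs.continuous.comp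
      ((glCoord n K).continuous.comp Units.continuous_val)))
  have hαs : IsArchSmooth (archGroupGL n K).carrier.subtype α := by
    have h := isArchSmooth_comp_glCoord (n := n) (K := K) (γ := fun s => ((c⁻¹ : ℝ) : ℂ) * (γ s : ℂ))
      (contDiff_const.mul (Complex.ofRealCLM.contDiff.comp hγs))
    exact h
  have hαcs : HasCompactSupport α := by
    refine HasCompactSupport.intro (hβc.image_of_continuousOn (continuousOn_unitOfCoord.mono hβU))
      fun x hx => ?_
    have hx' : glCoord n K (x : Matrix (Fin n) (Fin n) (mixedSpace K)) ∉ tsupport β := by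
      intro h
      exact hx ⟨_, h, unitOfCoord_glCoord x⟩
    have hβ0 : β (glCoord n K (x : Matrix (Fin n) (Fin n) (mixedSpace K))) = 0 :=
      image_eq_zero_of_notMem_tsupport hx'
    simp [hα, hγ, hβ0]
  refine ⟨α, hαc, hαcs, hαs, fun g => ?_⟩
  -- the identity
  set F₁ : GL (Fin n) (mixedSpace K) → ℂ := fun x => φ (g * GLn.ofInfinite n K x) with hF₁
  have hF₁c : Continuous F₁ :=
    hφ.continuous_gl.comp (continuous_const.mul (GLn.continuous_ofInfinite n K))
  -- (a) exponential coordinates: `φ g = ∫ α₀ · unitPull F₁ ∘ glCoord ∘ exp ∘ Λ`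
  have ha : φ g = ∫ t, (α₀ t : ℂ) * unitPull F₁ (glCoord n K (NormedSpace.exp (Λ t))) := by
    rw [hrep g]
    refine integral_congr_ae (Eventually.of_forall fun t => ?_)
    simp only [hexpΛ t, unitPull_glCoord, hF₁]
    rfl
  -- (b) linear coordinates and the Haar measure
  have hb : ∫ x, F₁ x * α x ∂ν = ∫ s, (β s : ℂ) * unitPull F₁ s := by
    rw [hhaar (fun x => F₁ x * α x) (hF₁c.mul hαc)]
    have hpt : ∀ s, unitPull (fun x => F₁ x * α x) s * (((haarWeightGL n K s)⁻¹ : ℝ) : ℂ) =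
        ((c⁻¹ : ℝ) : ℂ) * ((β s : ℂ) * unitPull F₁ s) := by
      intro s
      by_cases hs : s ∈ glUnitSet n K
      · have hw : haarWeightGL n K s ≠ 0 := (haarWeightGL_pos hs).ne'
        have hwC : (haarWeightGL n K s : ℂ) ≠ 0 := Complex.ofReal_ne_zero.2 hw
        have hcC : (c : ℂ) ≠ 0 := Complex.ofReal_ne_zero.2 hc.ne'
        rw [unitPull_of_mem _ hs, unitPull_of_mem _ hs]
        have hco : glCoord n K (((glUnitChart n K).symm (matOf s) : GL (Fin n) (mixedSpace K)) :
            Matrix (Fin n) (Fin n) (mixedSpace K)) = s := glCoord_unitOfCoord hs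
        simp only [hα, hγ, hco]
        push_cast
        field_simp
      · rw [unitPull_of_not_mem _ hs, unitPull_of_not_mem _ hs]; simp
    simp_rw [hpt]
    have hcC : (c : ℂ) ≠ 0 := Complex.ofReal_ne_zero.2 hc.ne'
    rw [integral_const_mul, ← mul_assoc,
      show (c : ℂ) * ((c⁻¹ : ℝ) : ℂ) = 1 by push_cast; exact mul_inv_cancel₀ hcC, one_mul]
  rw [hb, ← hβ (unitPull F₁), ← ha]

end Literature.NumberTheory.Automorphic
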